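import Summits.Ventures.WeilGRH.KeyPseudoAssembly
import HarnessLib

/-!
# Assembly by parity: the ODD pseudo-key floor, and the two-floor form of «t = 1 for every character»

Cell `rh-explicit`, WEIL TRACK — GRH ARM (weil-grh-5; sequel of `KeyPseudoAssembly.lean`, `GRH-LIT-AS-PRINTED.md`
A44).  weil-grh-2's exact pseudo-key floor ladder (EXTREMALS/GRH/trivial-key-minorant-CERT) has TWO columns per
rung: the EVEN all-trivial key `(0, log q₀, 1)` (covers every character, `KeyMinorantParity`) and the ODD all-trivial
key `(1, log q₁, 1)` (covers the odd characters, lower floor: `30 < 75` at `t = 1`).  This file adds the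
parity-`a` door and the two-floor assembly:

* `weilPositivityOnChar_of_pseudoKey_sections_nonneg_parity` — sections of `K(t)` PSD at the parity-`a` pseudo-key
  `(a, L₀, 1)` ⇒ `WeilPositivityOnChar χ t` for every `χ` mod `q ≠ 1` of parity `a` with `L₀ ≤ log q`;
* `weilPositivityOnChar_one_of_two_pseudoKeys_and_small` — at `t = 1`: [even key sections PSD at level `log q₀`]
  ∧ [odd key sections PSD at level `log q₁`] ∧ [rung at 1 for every character of modulus `2 ≤ q < q₀` that is
  NOT (odd with `q ≥ q₁`)] ⇒ rung at `t = 1` for every Dirichlet character of every modulus `q ≥ 2`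
  (numbers of record: `q₀ = 75`, `q₁ = 30`).

Everything is proved; no definitions, no named facts, RH/GRH-free; no certificate is evaluated.
[cite: Weil1952FormulesExplicites, (11) pp. 261–262; Yoshida1992, §0 p. 282]
-/

set_option autoImplicit false

noncomputable section

open Complex Filter Set MeasureTheory
open scoped Real Topology ComplexConjugate ArithmeticFunction.vonMangoldt

namespace Summit.Ventures.WeilGRH

open Literature.NumberTheory.LFunctions
open Literature.NumberTheory.LFunctions.Yoshida1992 (modes chi)
open Summit.RiemannHypothesis.RiemannHypothesis.Theorems.WeilFormatC

variable {q : ℕ}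

/-- **Parity-`a` pseudo-key sections PSD ⇒ the rung for every character OF PARITY `a` above the level.**
`a ≤ 1`, `t > 0`, `e^{2t} ≤ N + 1`; all trigonometric sections of `K(t)` have non-negative key form at
`(a, L₀, 1)`; then `WeilPositivityOnChar χ t` for every `χ` mod `q ≠ 1` with `charParity χ = a` and
`L₀ ≤ log q`. [cite: Yoshida1992, §0 p. 282; Weil1952FormulesExplicites, (11) pp. 261–262] -/
theorem weilPositivityOnChar_of_pseudoKey_sections_nonneg_parity {a : ℕ} (ha : a ≤ 1) {L₀ t : ℝ} (ht : 0 < t)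
    {N : ℕ} (hN : Real.exp (2 * t) ≤ (N : ℝ) + 1)
    (hsec : ∀ (M : ℕ) (c : ℤ → ℂ), 0 ≤ keyMarkovForm a L₀ (fun _ ↦ 1) t (∑ n ∈ modes M, c n • chi t n))
    (hq : q ≠ 1) (χ : DirichletCharacter ℂ q) (hpar : charParity χ = a) (hL : L₀ ≤ Real.log q) :
    WeilPositivityOnChar χ t := by
  refine weilPositivityOnChar_of_allTrivial_key_nonneg ha ht hN (fun g hg hsupp ↦ ?_) hq χ hpar hL
  rw [← keyMarkovForm_eq_weilFinitePrimeQuadraticKey hg hsupp hN ha L₀ (fun _ ↦ 1)]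
  exact keyMarkovForm_nonneg_of_forall_section_nonneg ht hsec (Yoshida1992.C_le_K ht ⟨hg, hsupp⟩)

/-- `e² ≤ 8`: the window `t = 1` sees the prime powers `n ≤ 7`. -/
private theorem exp_two_le_eight' : Real.exp (2 * (1 : ℝ)) ≤ ((7 : ℕ) : ℝ) + 1 := by
  have h := Real.exp_one_lt_d9
  have h0 := Real.exp_pos (1 : ℝ)
  rw [mul_one, show (2 : ℝ) = (1 : ℝ) + 1 by norm_num, Real.exp_add]
  push_cast
  nlinarith

/-- **«t = 1 for every Dirichlet character», two-floor assembly.**  Floors `2 ≤ q₁ ≤ q₀`.  If (i) every section of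
`K(1)` has non-negative key form at the EVEN pseudo-key `(0, log q₀, 1)`, (ii) the same at the ODD pseudo-key
`(1, log q₁, 1)`, and (iii) every Dirichlet character `χ` of modulus `2 ≤ q < q₀`, EXCEPT the odd ones with
`q ≥ q₁` (covered by (ii)), satisfies `WeilPositivityOnChar χ 1` — then every Dirichlet character of every modulus
`q ≥ 2` satisfies `WeilPositivityOnChar χ 1`.  (Numbers of record: `q₀ = 75`, `q₁ = 30`.)
[cite: Weil1952FormulesExplicites, (11) pp. 261–262] -/
theorem weilPositivityOnChar_one_of_two_pseudoKeys_and_small {q₀ q₁ : ℕ} (hq₁ : 2 ≤ q₁) (hq₀₁ : q₁ ≤ q₀)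
    (hsec₀ : ∀ (M : ℕ) (c : ℤ → ℂ),
      0 ≤ keyMarkovForm 0 (Real.log q₀) (fun _ ↦ 1) 1 (∑ n ∈ modes M, c n • chi 1 n))
    (hsec₁ : ∀ (M : ℕ) (c : ℤ → ℂ),
      0 ≤ keyMarkovForm 1 (Real.log q₁) (fun _ ↦ 1) 1 (∑ n ∈ modes M, c n • chi 1 n))
    (hsmall : ∀ q : ℕ, 2 ≤ q → q < q₀ → ∀ χ : DirichletCharacter ℂ q,
      ¬ (charParity χ = 1 ∧ q₁ ≤ q) → WeilPositivityOnChar χ 1)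
    (hq : 2 ≤ q) (χ : DirichletCharacter ℂ q) :
    WeilPositivityOnChar χ 1 := by
  have hq1 : q ≠ 1 := by omega
  by_cases hlt : q < q₀
  · by_cases hodd : charParity χ = 1 ∧ q₁ ≤ q
    · have hq₁pos : (0 : ℝ) < q₁ := by exact_mod_cast (by omega : 0 < q₁)
      have hL : Real.log q₁ ≤ Real.log q := Real.log_le_log hq₁pos (by exact_mod_cast hodd.2)
      exact weilPositivityOnChar_of_pseudoKey_sections_nonneg_parity le_rfl one_pos exp_two_le_eight' hsec₁
        hq1 χ hodd.1 hL
    · exact hsmall q hq hlt χ hodd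
  · push Not at hlt
    have hq₀pos : (0 : ℝ) < q₀ := by exact_mod_cast (by omega : 0 < q₀)
    have hL : Real.log q₀ ≤ Real.log q := Real.log_le_log hq₀pos (by exact_mod_cast hlt)
    exact weilPositivityOnChar_of_pseudoKey_sections_nonneg one_pos exp_two_le_eight' hsec₀ hq1 χ hL

end Summit.Ventures.WeilGRH

end
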